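import Summits.AtomisticToContinuum.HydrodynamicLimit.Theorems.ImplosionDichotomyPolynomialCompressionUniquenessEnergy
import Summits.AtomisticToContinuum.HydrodynamicLimit.Theorems.ImplosionDichotomyPolynomialCompressionUniquenessIdentity

/-!
# Uniqueness of classical hard-sphere Euler solutions with a smooth equation of state

Helper file for the line `log-lipschitz-budget` of the crux
`ImplosionDichotomy.PolynomialCompression` (stub `stub_conditionalExistence`, component (c)).
Two classical solutions `IsHardSphereEulerSolution σ T ρ u θ`, `IsHardSphereEulerSolution σ T ρ' u' θ'`
on `[0, T) × 𝕋³` whose pressure is `p = ρ θ ζ(ρ)` for ONE function `ζ` smooth on an open set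
`J ⊇ [a, b]`, whose densities take values in `[a, b]`, on which the system is hyperbolic
(`ζ + id·ζ' > 0` on `[a, b]`), and which have the same data at `t = 0`, coincide on `[0, T)`
(`hsEuler_unique_of_smooth_eos`). Proof: the relative-energy balance `∂ₜe + Σᵢ∂ᵢΦᵢ = R` of
`UniquenessIdentity`; every coefficient of the bilinear remainder `R` is a jointly smooth field,
hence bounded on compact time slabs (`UniquenessEnergy`), and `ζ`, `ζ + id·ζ'` are Lipschitz on
`[a, b]` (mean value theorem), so `R ≤ C (α² + β² + |w|²) ≤ C' e` on `[0, t₁] × 𝕋³`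
(`hsEuler_remainder_le`, `hsEuler_energy_ge`); the Grönwall shell
`torus_energy_eq_zero_of_balance` gives `e ≡ 0`, i.e. `ρ = ρ'`, `u = u'`, `θ = θ'`.
-/

noncomputable section

namespace Summit.AtomisticToContinuum.HydrodynamicLimit.Theorems

open Set Filter Topology MeasureTheory
open scoped ContDiff
open Literature.MathematicalPhysics.KineticTheory Literature.Analysis.FunctionSpaces

/-! ### Real-variable tools -/

/-- A function smooth on an open set `J` is Lipschitz on every compact interval `[a, b] ⊆ J`
(mean value theorem with the bound of the continuous derivative on `[a, b]`). [folklore] -/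
theorem exists_abs_sub_le_mul_of_contDiffOn {ζ : ℝ → ℝ} {J : Set ℝ} (hJ : IsOpen J)
    (hζ : ContDiffOn ℝ ∞ ζ J) {a b : ℝ} (hab : Icc a b ⊆ J) :
    ∃ L, 0 ≤ L ∧ ∀ r ∈ Icc a b, ∀ r' ∈ Icc a b, |ζ r - ζ r'| ≤ L * |r - r'| := by
  have hcont : ContinuousOn (deriv ζ) (Icc a b) :=
    ((hζ.deriv_of_isOpen (m := ∞) hJ le_rfl).continuousOn).mono hab
  obtain ⟨L, hL⟩ := isCompact_Icc.exists_bound_of_continuousOn hcont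
  refine ⟨max L 0, le_max_right _ _, fun r hr r' hr' => ?_⟩
  have hd : ∀ s ∈ Icc a b, HasDerivWithinAt ζ (deriv ζ s) (Icc a b) s := fun s hs =>
    (((hζ.differentiableOn (by simp)).differentiableAt (hJ.mem_nhds (hab hs))).hasDerivAt).hasDerivWithinAt
  have h := (convex_Icc a b).norm_image_sub_le_of_norm_hasDerivWithin_le hd
    (fun s hs => (hL s hs).trans (le_max_left L 0)) hr' hr
  simpa only [Real.norm_eq_abs] using h

/-- Chaining `R ≤ C q`, `m q ≤ E` (`q ≥ 0`, `m > 0`) into `R ≤ (max C 0 / m) E`. [folklore] -/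
theorem le_max_div_mul_of_le {R C q m E : ℝ} (h1 : R ≤ C * q) (h2 : m * q ≤ E) (hq : 0 ≤ q)
    (hm : 0 < m) : R ≤ max C 0 / m * E := by
  have h3 : R ≤ max C 0 * q := h1.trans (mul_le_mul_of_nonneg_right (le_max_left _ _) hq)
  have h4 : max C 0 * q = max C 0 / m * (m * q) := by
    field_simp
  rw [h4] at h3
  exact h3.trans (mul_le_mul_of_nonneg_left h2 (div_nonneg (le_max_right _ _) hm.le))

/-- **Absorption of the bilinear remainder** (pure algebra): a bilinear form in the small
quantities `α, β, wⱼ, δγ, δζ` with coefficients bounded by `K`, where `|δζ| ≤ L_ζ |α|` and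
`|δγ| ≤ L_γ |α|`, is bounded by `K (10 + 3L_γ² + 4L_ζ²)(α² + β² + Σⱼwⱼ²)`. [folklore] -/
theorem remainder_alg_le {c1 c2 c8 K al be dz dg Lz Lg : ℝ} {c3 c5 c6 c7 w : Fin 3 → ℝ}
    {c4 : Fin 3 → Fin 3 → ℝ} (h1 : |c1| ≤ K) (h2 : |c2| ≤ K) (h3 : ∀ j, |c3 j| ≤ K)
    (h4 : ∀ i j, |c4 i j| ≤ K) (h5 : ∀ j, |c5 j| ≤ K) (h6 : ∀ j, |c6 j| ≤ K) (h7 : ∀ j, |c7 j| ≤ K)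
    (h8 : |c8| ≤ K) (hz : |dz| ≤ Lz * |al|) (hg : |dg| ≤ Lg * |al|) :
    c1 * al ^ 2 + c2 * be ^ 2 + ∑ j, c3 j * al * w j + ∑ i, ∑ j, c4 i j * w i * w j +
      ∑ j, c5 j * be * w j + ∑ j, c6 j * dg * w j + ∑ j, c7 j * dz * w j + c8 * be * dz ≤
      K * (10 + 3 * Lg ^ 2 + 4 * Lz ^ 2) * (al ^ 2 + be ^ 2 + ∑ j, w j ^ 2) := by
  have hK : 0 ≤ K := (abs_nonneg _).trans h1
  have e1 : c1 * al ^ 2 ≤ K * al ^ 2 :=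
    (le_abs_self _).trans (by rw [abs_mul, abs_pow, sq_abs]; exact mul_le_mul_of_nonneg_right h1 (sq_nonneg _))
  have e2 : c2 * be ^ 2 ≤ K * be ^ 2 :=
    (le_abs_self _).trans (by rw [abs_mul, abs_pow, sq_abs]; exact mul_le_mul_of_nonneg_right h2 (sq_nonneg _))
  have e3 : ∑ j, c3 j * al * w j ≤ K * ∑ j, (al ^ 2 + w j ^ 2) :=
    (le_abs_self _).trans (abs_sum_mul_mul_le _ fun k _ => h3 k)
  have e4 : ∑ i, ∑ j, c4 i j * w i * w j ≤ ∑ i, K * ∑ j, (w i ^ 2 + w j ^ 2) :=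
    Finset.sum_le_sum fun i _ => (le_abs_self _).trans (abs_sum_mul_mul_le _ fun k _ => h4 i k)
  have e5 : ∑ j, c5 j * be * w j ≤ K * ∑ j, (be ^ 2 + w j ^ 2) :=
    (le_abs_self _).trans (abs_sum_mul_mul_le _ fun k _ => h5 k)
  have e6 : ∑ j, c6 j * dg * w j ≤ K * ∑ j, (dg ^ 2 + w j ^ 2) :=
    (le_abs_self _).trans (abs_sum_mul_mul_le _ fun k _ => h6 k)
  have e7 : ∑ j, c7 j * dz * w j ≤ K * ∑ j, (dz ^ 2 + w j ^ 2) :=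
    (le_abs_self _).trans (abs_sum_mul_mul_le _ fun k _ => h7 k)
  have e8 : c8 * be * dz ≤ K * (be ^ 2 + dz ^ 2) := by
    have h := abs_sum_mul_mul_le {(0 : Fin 3)} (c := fun _ => c8) (a := fun _ => be) (b := fun _ => dz)
      (K := K) fun _ _ => h8
    simp only [Finset.sum_singleton] at h
    exact (le_abs_self _).trans h
  have hdg2 : dg ^ 2 ≤ Lg ^ 2 * al ^ 2 := by
    have h := pow_le_pow_left₀ (abs_nonneg _) hg 2
    rw [sq_abs, mul_pow, sq_abs] at h
    exact h
  have hdz2 : dz ^ 2 ≤ Lz ^ 2 * al ^ 2 := by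
    have h := pow_le_pow_left₀ (abs_nonneg _) hz 2
    rw [sq_abs, mul_pow, sq_abs] at h
    exact h
  have hKdg : K * dg ^ 2 ≤ K * (Lg ^ 2 * al ^ 2) := mul_le_mul_of_nonneg_left hdg2 hK
  have hKdz : K * dz ^ 2 ≤ K * (Lz ^ 2 * al ^ 2) := mul_le_mul_of_nonneg_left hdz2 hK
  simp only [Fin.sum_univ_three] at e3 e4 e5 e6 e7 ⊢
  nlinarith [mul_nonneg hK (sq_nonneg al), mul_nonneg hK (sq_nonneg be), mul_nonneg hK (sq_nonneg (w 0)),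
    mul_nonneg hK (sq_nonneg (w 1)), mul_nonneg hK (sq_nonneg (w 2)),
    mul_nonneg hK (mul_nonneg (sq_nonneg Lg) (sq_nonneg al)),
    mul_nonneg hK (mul_nonneg (sq_nonneg Lz) (sq_nonneg al))]

/-- **Coercivity of the relative energy** (pure algebra): with `A ≥ a₀ > 0`, `ρ ≥ ρ₀ > 0`,
`B ≥ b₀ > 0`, `½(A α² + ρ n + B β²) ≥ (min(a₀, ρ₀, b₀)/2)(α² + β² + n)` for `n ≥ 0`. [folklore] -/
theorem energy_alg_ge {A r B a0 r0 b0 al be n : ℝ} (ha : a0 ≤ A) (hr : r0 ≤ r) (hb : b0 ≤ B)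
    (hn : 0 ≤ n) :
    min (min a0 r0) b0 / 2 * (al ^ 2 + be ^ 2 + n) ≤ 1 / 2 * (A * al ^ 2 + r * n + B * be ^ 2) := by
  have h1 : min (min a0 r0) b0 ≤ a0 := (min_le_left _ _).trans (min_le_left _ _)
  have h2 : min (min a0 r0) b0 ≤ r0 := (min_le_left _ _).trans (min_le_right _ _)
  have h3 : min (min a0 r0) b0 ≤ b0 := min_le_right _ _
  nlinarith [mul_le_mul_of_nonneg_right (h1.trans ha) (sq_nonneg al),
    mul_le_mul_of_nonneg_right (h2.trans hr) hn, mul_le_mul_of_nonneg_right (h3.trans hb) (sq_nonneg be)]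

/-- **Vanishing of the relative energy forces equality** (pure algebra): with `A, ρ, B > 0`,
`½(A α² + ρ ‖w‖² + B β²) = 0` gives `α = 0`, `w = 0`, `β = 0`. [folklore] -/
theorem eq_of_energy_eq_zero {A r B al be : ℝ} {w : V3} (hA : 0 < A) (hr : 0 < r) (hB : 0 < B)
    (h : 1 / 2 * (A * al ^ 2 + r * ‖w‖ ^ 2 + B * be ^ 2) = 0) : al = 0 ∧ w = 0 ∧ be = 0 := by
  have h1 : 0 ≤ A * al ^ 2 := mul_nonneg hA.le (sq_nonneg _)
  have h2 : 0 ≤ r * ‖w‖ ^ 2 := mul_nonneg hr.le (sq_nonneg _)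
  have h3 : 0 ≤ B * be ^ 2 := mul_nonneg hB.le (sq_nonneg _)
  have hal : A * al ^ 2 = 0 := by linarith
  have hw : r * ‖w‖ ^ 2 = 0 := by linarith
  have hbe : B * be ^ 2 = 0 := by linarith
  refine ⟨?_, ?_, ?_⟩
  · simpa [hA.ne'] using hal
  · simpa [hr.ne'] using hw
  · simpa [hB.ne'] using hbe

/-! ### The remainder and the energy along two solutions -/

section Solutions

variable {σ T : ℝ} {ρ θ ρ' θ' : ℝ → T3 → ℝ} {u u' : ℝ → T3 → V3} {ζ : ℝ → ℝ} {J : Set ℝ} {a b : ℝ}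

/-- **The remainder is absorbed by the quadratic size of the difference** on compact time slabs:
for two classical solutions with densities valued in `[a, b] ⊆ J` (`ζ` smooth on the open set `J`),
the remainder `R` of `hsEuler_relativeEnergy_balance` satisfies `R ≤ C (α² + β² + |w|²)` on
`[0, t₁] × 𝕋³`, `t₁ < T` (every coefficient is a jointly smooth field, bounded on the slab;
`ζ` and `ζ + id·ζ'` are Lipschitz on `[a, b]`). [folklore] -/
theorem hsEuler_remainder_le (hE : IsHardSphereEulerSolution σ T ρ u θ)
    (hE' : IsHardSphereEulerSolution σ T ρ' u' θ') (hJ : IsOpen J) (hζ : ContDiffOn ℝ ∞ ζ J)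
    (hab : Icc a b ⊆ J) (hρab : ∀ t ∈ Ico 0 T, ∀ x, ρ t x ∈ Icc a b)
    (hρab' : ∀ t ∈ Ico 0 T, ∀ x, ρ' t x ∈ Icc a b) {t₁ : ℝ} (ht₁ : t₁ ∈ Ico 0 T) :
    ∃ C : ℝ, ∀ t ∈ Icc 0 t₁, ∀ x,
      -- α² and β²
      (1 / 2 * Torus.timeDerivWithin (Ico 0 T)
            (fun s y => θ s y * (ζ (ρ s y) + ρ s y * deriv ζ (ρ s y)) / ρ s y) t x -
          θ t x * (ζ (ρ t x) + ρ t x * deriv ζ (ρ t x)) / ρ t x *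
            ∑ i, Torus.partialDeriv i (fun y => u' t y i) x +
          1 / 2 * ∑ i, Torus.partialDeriv i
            (fun y => θ t y * (ζ (ρ t y) + ρ t y * deriv ζ (ρ t y)) / ρ t y * u t y i) x) *
        (ρ t x - ρ' t x) ^ 2 +
      (1 / 2 * Torus.timeDerivWithin (Ico 0 T) (fun s y => 3 / 2 * ρ s y / θ s y) t x -
          2 / 3 * (3 / 2 * ρ t x / θ t x) * ζ (ρ t x) *
            ∑ i, Torus.partialDeriv i (fun y => u' t y i) x +
          1 / 2 * ∑ i, Torus.partialDeriv i (fun y => 3 / 2 * ρ t y / θ t y * u t y i) x) *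
        (θ t x - θ' t x) ^ 2 +
      -- α wⱼ
      ∑ j, (-(θ t x * (ζ (ρ t x) + ρ t x * deriv ζ (ρ t x)) / ρ t x *
              Torus.partialDeriv j (ρ' t) x) -
            ∑ i, u' t x i * Torus.partialDeriv i (fun y => u' t y j) x -
            ζ (ρ t x) * Torus.partialDeriv j (θ' t) x -
            Torus.timeDerivWithin (Ico 0 T) (fun s y => u' s y j) t x +
            Torus.partialDeriv j (fun y => θ t y * (ζ (ρ t y) + ρ t y * deriv ζ (ρ t y))) x) *
          (ρ t x - ρ' t x) * (u t x j - u' t x j) +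
      -- wᵢ wⱼ
      ∑ i, ∑ j, -(ρ t x * Torus.partialDeriv i (fun y => u' t y j) x) *
          (u t x i - u' t x i) * (u t x j - u' t x j) +
      -- β wⱼ
      ∑ j, (-((ζ (ρ t x) + ρ t x * deriv ζ (ρ t x)) * Torus.partialDeriv j (ρ' t) x) -
            3 / 2 * ρ t x / θ t x * Torus.partialDeriv j (θ' t) x +
            Torus.partialDeriv j (fun y => ρ t y * ζ (ρ t y)) x) *
          (θ t x - θ' t x) * (u t x j - u' t x j) +
      -- (γ(ρ) - γ(ρ')) wⱼ and (ζ(ρ) - ζ(ρ')) wⱼ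
      ∑ j, -(θ' t x * Torus.partialDeriv j (ρ' t) x) *
          ((ζ (ρ t x) + ρ t x * deriv ζ (ρ t x)) - (ζ (ρ' t x) + ρ' t x * deriv ζ (ρ' t x))) *
          (u t x j - u' t x j) +
      ∑ j, -(ρ' t x * Torus.partialDeriv j (θ' t) x) * (ζ (ρ t x) - ζ (ρ' t x)) *
          (u t x j - u' t x j) +
      -- β (ζ(ρ) - ζ(ρ'))
      -(2 / 3 * (3 / 2 * ρ t x / θ t x) * θ' t x * ∑ i, Torus.partialDeriv i (fun y => u' t y i) x) *
        (θ t x - θ' t x) * (ζ (ρ t x) - ζ (ρ' t x)) ≤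
      C * ((ρ t x - ρ' t x) ^ 2 + (θ t x - θ' t x) ^ 2 + ‖u t x - u' t x‖ ^ 2) := by
  have hU : UniqueDiffOn ℝ (Ico (0 : ℝ) T) := uniqueDiffOn_Ico 0 T
  have hρJ : ∀ t ∈ Ico 0 T, ∀ x, ρ t x ∈ J := fun t ht x => hab (hρab t ht x)
  have hρJ' : ∀ t ∈ Ico 0 T, ∀ x, ρ' t x ∈ J := fun t ht x => hab (hρab' t ht x)
  -- the atoms: jointly smooth fields on `[0, T) × 𝕋³`
  have hρ := hE.smooth_density
  have hθ := hE.smooth_temperature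
  have hu := hE.smooth_velocity
  have hρ' := hE'.smooth_density
  have hθ' := hE'.smooth_temperature
  have hu' := hE'.smooth_velocity
  have hζρ := isSmoothSpaceTimeOn_comp_density hρ hζ hρJ
  have hζdρ := isSmoothSpaceTimeOn_comp_density hρ (hζ.deriv_of_isOpen (m := ∞) hJ le_rfl) hρJ
  have hAf := isSmoothSpaceTimeOn_weightA hE hJ hζ hρJ
  have hBf := isSmoothSpaceTimeOn_weightB hE
  have hγf : Torus.IsSmoothSpaceTimeOn (Ico 0 T)
      (fun s y => ζ (ρ s y) + ρ s y * deriv ζ (ρ s y)) := hζρ.add (hρ.mul hζdρ)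
  have hAt := hAf.timeDerivWithin hU
  have hBt := hBf.timeDerivWithin hU
  have hdU : ∀ i j, Torus.IsSmoothSpaceTimeOn (Ico 0 T)
      (fun t => Torus.partialDeriv i (fun y => u' t y j)) := fun i j => (hu'.apply j).partialDeriv hU i
  have hdR : ∀ j, Torus.IsSmoothSpaceTimeOn (Ico 0 T) (fun t => Torus.partialDeriv j (ρ' t)) :=
    fun j => hρ'.partialDeriv hU j
  have hdH : ∀ j, Torus.IsSmoothSpaceTimeOn (Ico 0 T) (fun t => Torus.partialDeriv j (θ' t)) :=
    fun j => hθ'.partialDeriv hU j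
  have hUt : ∀ j, Torus.IsSmoothSpaceTimeOn (Ico 0 T)
      (Torus.timeDerivWithin (Ico 0 T) (fun s y => u' s y j)) := fun j => (hu'.apply j).timeDerivWithin hU
  have hDAu : ∀ i, Torus.IsSmoothSpaceTimeOn (Ico 0 T) (fun t => Torus.partialDeriv i
      (fun y => θ t y * (ζ (ρ t y) + ρ t y * deriv ζ (ρ t y)) / ρ t y * u t y i)) :=
    fun i => (hAf.mul (hu.apply i)).partialDeriv hU i
  have hDBu : ∀ i, Torus.IsSmoothSpaceTimeOn (Ico 0 T) (fun t => Torus.partialDeriv i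
      (fun y => 3 / 2 * ρ t y / θ t y * u t y i)) := fun i => (hBf.mul (hu.apply i)).partialDeriv hU i
  have hDpr : ∀ j, Torus.IsSmoothSpaceTimeOn (Ico 0 T) (fun t => Torus.partialDeriv j
      (fun y => θ t y * (ζ (ρ t y) + ρ t y * deriv ζ (ρ t y)))) := fun j => (hθ.mul hγf).partialDeriv hU j
  have hDph : ∀ j, Torus.IsSmoothSpaceTimeOn (Ico 0 T) (fun t => Torus.partialDeriv j
      (fun y => ρ t y * ζ (ρ t y))) := fun j => (hρ.mul hζρ).partialDeriv hU j
  have hc : ∀ c : ℝ, Torus.IsSmoothSpaceTimeOn (Ico 0 T) (fun (_ : ℝ) (_ : T3) => c) := fun c =>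
    Torus.isSmoothSpaceTimeOn_const (Torus.isSmooth_const c) _
  have hSdU : Torus.IsSmoothSpaceTimeOn (Ico 0 T)
      (fun t x => ∑ i, Torus.partialDeriv i (fun y => u' t y i) x) :=
    Torus.IsSmoothSpaceTimeOn.sum fun i _ => hdU i i
  -- bounds of the eight coefficient families on `[0, t₁] × 𝕋³`
  obtain ⟨K1, hK1₀, hK1⟩ := exists_abs_le_of_isSmoothSpaceTimeOn
    ((((hc (1 / 2)).mul hAt).sub (hAf.mul hSdU)).add ((hc (1 / 2)).mul
      (Torus.IsSmoothSpaceTimeOn.sum fun i _ => hDAu i))) ht₁.2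
  obtain ⟨K2, hK2₀, hK2⟩ := exists_abs_le_of_isSmoothSpaceTimeOn
    ((((hc (1 / 2)).mul hBt).sub ((((hc (2 / 3)).mul hBf).mul hζρ).mul hSdU)).add ((hc (1 / 2)).mul
      (Torus.IsSmoothSpaceTimeOn.sum fun i _ => hDBu i))) ht₁.2
  obtain ⟨K3, hK3₀, hK3⟩ := exists_forall_abs_le_of_isSmoothSpaceTimeOn (fun j =>
    (((((hAf.mul (hdR j)).neg.sub (Torus.IsSmoothSpaceTimeOn.sum fun i _ =>
      (hu'.apply i).mul (hdU i j))).sub (hζρ.mul (hdH j))).sub (hUt j)).add (hDpr j))) ht₁.2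
  obtain ⟨K4, hK4₀, hK4⟩ := exists_forall_abs_le_of_isSmoothSpaceTimeOn
    (fun p : Fin 3 × Fin 3 => (hρ.mul (hdU p.1 p.2)).neg) ht₁.2
  obtain ⟨K5, hK5₀, hK5⟩ := exists_forall_abs_le_of_isSmoothSpaceTimeOn (fun j =>
    ((hγf.mul (hdR j)).neg.sub (hBf.mul (hdH j))).add (hDph j)) ht₁.2
  obtain ⟨K6, hK6₀, hK6⟩ := exists_forall_abs_le_of_isSmoothSpaceTimeOn (fun j =>
    (hθ'.mul (hdR j)).neg) ht₁.2
  obtain ⟨K7, hK7₀, hK7⟩ := exists_forall_abs_le_of_isSmoothSpaceTimeOn (fun j =>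
    (hρ'.mul (hdH j)).neg) ht₁.2
  obtain ⟨K8, hK8₀, hK8⟩ := exists_abs_le_of_isSmoothSpaceTimeOn
    ((((hc (2 / 3)).mul hBf).mul hθ').mul hSdU).neg ht₁.2
  -- Lipschitz constants of `ζ` and `ζ + id·ζ'` on `[a, b]`
  obtain ⟨Lz, -, hLz⟩ := exists_abs_sub_le_mul_of_contDiffOn hJ hζ hab
  obtain ⟨Lg, -, hLg⟩ := exists_abs_sub_le_mul_of_contDiffOn hJ
    (hζ.add (contDiffOn_id.mul (hζ.deriv_of_isOpen (m := ∞) hJ le_rfl))) hab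
  set K : ℝ := K1 + K2 + K3 + K4 + K5 + K6 + K7 + K8 with hK
  refine ⟨K * (10 + 3 * Lg ^ 2 + 4 * Lz ^ 2), fun t ht x => ?_⟩
  have htT : t ∈ Ico 0 T := ⟨ht.1, ht.2.trans_lt ht₁.2⟩
  have hnorm : ‖u t x - u' t x‖ ^ 2 = ∑ j, (u t x j - u' t x j) ^ 2 := by
    simp only [EuclideanSpace.norm_sq_eq, PiLp.sub_apply, Real.norm_eq_abs, sq_abs]
  rw [hnorm]
  apply remainder_alg_le
  · exact (hK1 t ht x).trans (by linarith)
  · exact (hK2 t ht x).trans (by linarith)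
  · exact fun j => (hK3 j t ht x).trans (by linarith)
  · exact fun i j => (hK4 (i, j) t ht x).trans (by linarith)
  · exact fun j => (hK5 j t ht x).trans (by linarith)
  · exact fun j => (hK6 j t ht x).trans (by linarith)
  · exact fun j => (hK7 j t ht x).trans (by linarith)
  · exact (hK8 t ht x).trans (by linarith)
  · exact hLz _ (hρab t htT x) _ (hρab' t htT x)
  · simpa only [id] using hLg _ (hρab t htT x) _ (hρab' t htT x)

/-- **Coercivity of the relative energy** on compact time slabs: `e ≥ m (α² + β² + |w|²)` on
`[0, t₁] × 𝕋³` with `m > 0` (the weights `A`, `ρ`, `B` are positive jointly smooth fields, hence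
bounded below on the slab; hyperbolicity `ζ + id·ζ' > 0` on `[a, b]` makes `A > 0`). [folklore] -/
theorem hsEuler_energy_ge (hE : IsHardSphereEulerSolution σ T ρ u θ) (hJ : IsOpen J)
    (hζ : ContDiffOn ℝ ∞ ζ J) (hab : Icc a b ⊆ J) (hγ : ∀ r ∈ Icc a b, 0 < ζ r + r * deriv ζ r)
    (hρab : ∀ t ∈ Ico 0 T, ∀ x, ρ t x ∈ Icc a b) (ρ' θ' : ℝ → T3 → ℝ) (u' : ℝ → T3 → V3)
    {t₁ : ℝ} (ht₁ : t₁ ∈ Ico 0 T) :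
    ∃ m : ℝ, 0 < m ∧ ∀ t ∈ Icc 0 t₁, ∀ x,
      m * ((ρ t x - ρ' t x) ^ 2 + (θ t x - θ' t x) ^ 2 + ‖u t x - u' t x‖ ^ 2) ≤
        1 / 2 * (θ t x * (ζ (ρ t x) + ρ t x * deriv ζ (ρ t x)) / ρ t x * (ρ t x - ρ' t x) ^ 2 +
          ρ t x * ‖u t x - u' t x‖ ^ 2 + 3 / 2 * ρ t x / θ t x * (θ t x - θ' t x) ^ 2) := by
  have hρJ : ∀ t ∈ Ico 0 T, ∀ x, ρ t x ∈ J := fun t ht x => hab (hρab t ht x)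
  have hAf := isSmoothSpaceTimeOn_weightA hE hJ hζ hρJ
  have hBf := isSmoothSpaceTimeOn_weightB hE
  have hApos : ∀ t ∈ Ico 0 T, ∀ x, 0 < θ t x * (ζ (ρ t x) + ρ t x * deriv ζ (ρ t x)) / ρ t x :=
    fun t ht x => div_pos (mul_pos (hE.temperature_pos t ht x) (hγ _ (hρab t ht x)))
      (hE.density_pos t ht x)
  have hBpos : ∀ t ∈ Ico 0 T, ∀ x, 0 < 3 / 2 * ρ t x / θ t x := fun t ht x =>
    div_pos (mul_pos (by norm_num) (hE.density_pos t ht x)) (hE.temperature_pos t ht x)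
  obtain ⟨a0, ha0, ha⟩ := exists_pos_le_of_isSmoothSpaceTimeOn hAf hApos ht₁.2
  obtain ⟨r0, hr0, hr⟩ := exists_pos_le_of_isSmoothSpaceTimeOn hE.smooth_density hE.density_pos ht₁.2
  obtain ⟨b0, hb0, hb⟩ := exists_pos_le_of_isSmoothSpaceTimeOn hBf hBpos ht₁.2
  refine ⟨min (min a0 r0) b0 / 2, by positivity, fun t ht x => ?_⟩
  exact energy_alg_ge (ha t ht x) (hr t ht x) (hb t ht x) (sq_nonneg _)

/-- **Uniqueness of classical hard-sphere Euler solutions with a smooth, hyperbolic equation of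
state.** Let `ζ` be smooth on an open set `J ⊇ [a, b]` with `ζ(r) + r ζ'(r) > 0` on `[a, b]`
(hyperbolicity: `∂p/∂ρ = θ (ζ + ρζ') > 0`). Two classical solutions of the hard-sphere Euler system
on `[0, T) × 𝕋³` whose pressure fields are `ρ θ ζ(ρ)` resp. `ρ' θ' ζ(ρ')` pointwise, whose
densities take values in `[a, b]`, and which have the same density, velocity and temperature at
`t = 0`, coincide on `[0, T)` (relative-energy method + Grönwall on `𝕋³`). [folklore] -/
theorem hsEuler_unique_of_smooth_eos :
    ∀ {σ T : ℝ} {ρ θ ρ' θ' : ℝ → T3 → ℝ} {u u' : ℝ → T3 → V3} {ζ : ℝ → ℝ} {J : Set ℝ} {a b : ℝ},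
      IsHardSphereEulerSolution σ T ρ u θ → IsHardSphereEulerSolution σ T ρ' u' θ' → IsOpen J →
      ContDiffOn ℝ (⊤ : ℕ∞) ζ J → Icc a b ⊆ J → (∀ r ∈ Icc a b, 0 < ζ r + r * deriv ζ r) →
      (∀ t ∈ Ico 0 T, ∀ x, ρ t x ∈ Icc a b) → (∀ t ∈ Ico 0 T, ∀ x, ρ' t x ∈ Icc a b) →
      (∀ t ∈ Ico 0 T, ∀ x, hsPressure σ (ρ t x) (θ t x) = ρ t x * θ t x * ζ (ρ t x)) →
      (∀ t ∈ Ico 0 T, ∀ x, hsPressure σ (ρ' t x) (θ' t x) = ρ' t x * θ' t x * ζ (ρ' t x)) →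
      ρ 0 = ρ' 0 → u 0 = u' 0 → θ 0 = θ' 0 →
      ∀ t ∈ Ico 0 T, ρ t = ρ' t ∧ u t = u' t ∧ θ t = θ' t := by
  intro σ T ρ θ ρ' θ' u u' ζ J a b hE hE' hJ hζ hab hγ hρab hρab' hp hp' h0 hu0 hθ0
  have hρJ : ∀ t ∈ Ico 0 T, ∀ x, ρ t x ∈ J := fun t ht x => hab (hρab t ht x)
  have hρJ' : ∀ t ∈ Ico 0 T, ∀ x, ρ' t x ∈ J := fun t ht x => hab (hρab' t ht x)
  have hρ := hE.smooth_density
  have hθ := hE.smooth_temperature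
  have hu := hE.smooth_velocity
  have hρ' := hE'.smooth_density
  have hθ' := hE'.smooth_temperature
  have hu' := hE'.smooth_velocity
  have hζρ := isSmoothSpaceTimeOn_comp_density hρ hζ hρJ
  have hζdρ := isSmoothSpaceTimeOn_comp_density hρ (hζ.deriv_of_isOpen (m := ∞) hJ le_rfl) hρJ
  have hAf := isSmoothSpaceTimeOn_weightA hE hJ hζ hρJ
  have hBf := isSmoothSpaceTimeOn_weightB hE
  have hγf : Torus.IsSmoothSpaceTimeOn (Ico 0 T)
      (fun s y => ζ (ρ s y) + ρ s y * deriv ζ (ρ s y)) := hζρ.add (hρ.mul hζdρ)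
  -- the energy density and the fluxes are jointly smooth
  have hal2 : Torus.IsSmoothSpaceTimeOn (Ico 0 T) (fun t x => (ρ t x - ρ' t x) ^ 2) :=
    (hρ.sub hρ').pow 2
  have hbe2 : Torus.IsSmoothSpaceTimeOn (Ico 0 T) (fun t x => (θ t x - θ' t x) ^ 2) :=
    (hθ.sub hθ').pow 2
  have hw2 : Torus.IsSmoothSpaceTimeOn (Ico 0 T) (fun t x => ‖u t x - u' t x‖ ^ 2) :=
    (hu.sub hu').norm_sq ℝ
  have hhalf : Torus.IsSmoothSpaceTimeOn (Ico 0 T) (fun (_ : ℝ) (_ : T3) => (1 / 2 : ℝ)) :=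
    Torus.isSmoothSpaceTimeOn_const (Torus.isSmooth_const _) _
  have he : Torus.IsSmoothSpaceTimeOn (Ico 0 T) (fun s y => 1 / 2 *
      (θ s y * (ζ (ρ s y) + ρ s y * deriv ζ (ρ s y)) / ρ s y * (ρ s y - ρ' s y) ^ 2 +
        ρ s y * ‖u s y - u' s y‖ ^ 2 + 3 / 2 * ρ s y / θ s y * (θ s y - θ' s y) ^ 2)) :=
    hhalf.mul (((hAf.mul hal2).add (hρ.mul hw2)).add (hBf.mul hbe2))
  have hΦ : ∀ i, Torus.IsSmoothSpaceTimeOn (Ico 0 T) (fun t y =>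
      1 / 2 * (θ t y * (ζ (ρ t y) + ρ t y * deriv ζ (ρ t y)) / ρ t y * u t y i *
            (ρ t y - ρ' t y) ^ 2 +
          ρ t y * u t y i * ‖u t y - u' t y‖ ^ 2 +
          3 / 2 * ρ t y / θ t y * u t y i * (θ t y - θ' t y) ^ 2) +
        θ t y * (ζ (ρ t y) + ρ t y * deriv ζ (ρ t y)) * (ρ t y - ρ' t y) * (u t y i - u' t y i) +
        ρ t y * ζ (ρ t y) * (θ t y - θ' t y) * (u t y i - u' t y i)) := fun i =>
    ((hhalf.mul ((((hAf.mul (hu.apply i)).mul hal2).add ((hρ.mul (hu.apply i)).mul hw2)).add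
      ((hBf.mul (hu.apply i)).mul hbe2))).add
      (((hθ.mul hγf).mul (hρ.sub hρ')).mul ((hu.apply i).sub (hu'.apply i)))).add
      (((hρ.mul hζρ).mul (hθ.sub hθ')).mul ((hu.apply i).sub (hu'.apply i)))
  have hApos : ∀ t ∈ Ico 0 T, ∀ x, 0 < θ t x * (ζ (ρ t x) + ρ t x * deriv ζ (ρ t x)) / ρ t x :=
    fun t ht x => div_pos (mul_pos (hE.temperature_pos t ht x) (hγ _ (hρab t ht x)))
      (hE.density_pos t ht x)
  have hBpos : ∀ t ∈ Ico 0 T, ∀ x, 0 < 3 / 2 * ρ t x / θ t x := fun t ht x =>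
    div_pos (mul_pos (by norm_num) (hE.density_pos t ht x)) (hE.temperature_pos t ht x)
  have hzero := torus_energy_eq_zero_of_balance (Φ := fun i t y =>
      1 / 2 * (θ t y * (ζ (ρ t y) + ρ t y * deriv ζ (ρ t y)) / ρ t y * u t y i *
            (ρ t y - ρ' t y) ^ 2 +
          ρ t y * u t y i * ‖u t y - u' t y‖ ^ 2 +
          3 / 2 * ρ t y / θ t y * u t y i * (θ t y - θ' t y) ^ 2) +
        θ t y * (ζ (ρ t y) + ρ t y * deriv ζ (ρ t y)) * (ρ t y - ρ' t y) * (u t y i - u' t y i) +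
        ρ t y * ζ (ρ t y) * (θ t y - θ' t y) * (u t y i - u' t y i)) he hΦ
    (fun t ht x => ?_) (fun x => ?_) (fun t₁ ht₁ => ?_)
  · -- conclusion: the energy density vanishes, hence so do `α`, `w`, `β`
    intro t ht
    have hpt : ∀ x, ρ t x - ρ' t x = 0 ∧ u t x - u' t x = 0 ∧ θ t x - θ' t x = 0 := fun x =>
      eq_of_energy_eq_zero (hApos t ht x) (hE.density_pos t ht x) (hBpos t ht x) (hzero t ht x)
    exact ⟨funext fun x => sub_eq_zero.1 (hpt x).1, funext fun x => sub_eq_zero.1 (hpt x).2.1,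
      funext fun x => sub_eq_zero.1 (hpt x).2.2⟩
  · -- `e ≥ 0`
    exact mul_nonneg (by norm_num) (add_nonneg (add_nonneg
      (mul_nonneg (hApos t ht x).le (sq_nonneg _))
      (mul_nonneg (hE.density_pos t ht x).le (sq_nonneg _)))
      (mul_nonneg (hBpos t ht x).le (sq_nonneg _)))
  · -- `e(0, ·) = 0`
    rw [show ρ 0 x = ρ' 0 x from congrFun h0 x, show u 0 x = u' 0 x from congrFun hu0 x,
      show θ 0 x = θ' 0 x from congrFun hθ0 x]
    simp
  · -- the balance `∂ₜe + Σᵢ∂ᵢΦᵢ = R ≤ C e` on `[0, t₁] × 𝕋³`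
    obtain ⟨C, hC⟩ := hsEuler_remainder_le hE hE' hJ hζ hab hρab hρab' ht₁
    obtain ⟨m, hm0, hm⟩ := hsEuler_energy_ge hE hJ hζ hab hγ hρab ρ' θ' u' ht₁
    refine ⟨max C 0 / m, fun t ht x => ?_⟩
    have htT : t ∈ Ico 0 T := ⟨ht.1, ht.2.trans_lt ht₁.2⟩
    exact (hsEuler_relativeEnergy_balance hE hE' hJ hζ hρJ hρJ' hp hp' htT x).trans_le
      (le_max_div_mul_of_le (hC t ht x) (hm t ht x) (by positivity) hm0)

end Solutions

end Summit.AtomisticToContinuum.HydrodynamicLimit.Theorems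

end
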